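import Summits.QuantumFields.BalabanUV.Beta.D1BFx.TadpoleRest
import Summits.QuantumFields.BalabanUV.Beta.D1BFx.SplitRecut
import Literature.MathematicalPhysics.QuantumFieldTheory.Balaban1983to89.Beta.LatticeConstantZl
import Summits.QuantumFields.BalabanUV.Beta.D1BFx.DiagonalLegGrade
import Summits.QuantumFields.BalabanUV.Beta.D1BFx.PointColumnSplit
import Summits.QuantumFields.BalabanUV.Beta.D1BFx.GhostBubbleRestFrozen

/-!
# `BalabanUV.Beta.D1BFx.LocalTadpoleRows` — road «BF-x» for binder row D1, slot (K), END rest row, LOCAL GROUP (`RoadEndBFxRows.hGrp_of_rows`, p256389,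
# hypothesis `hLoc`), «L-TAD-EJ» of the owner's `K-LOCAL-ROWS.md` v0: **THE GLUON TADPOLE WORDS `Sum.inl (s, r)` OF A LOCAL SLOT TABLE, IN THE END's
# PER-WORD CURRENCY** — leaf A6 ∕ `TadpoleRest` BY NAME with BOTH leg entry bounds discharged (`GluonLeg.abs_Ga_le`, `TadpoleRest.abs_gfrz_le`: `n²∕γ₀(4,a)`
# each), the n-uniformity isolated in ONE displayed scalar inequality and made explicit under a scaling letter (tolerance `n⁶`)

## v1.1 (2026-08-21; same seat; owner ruling ρ-g9-29 U3.E∕U3.J «route (β): re-feed the leg entry bounds n-FREE … output CL n-free; the WJ words are VOID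
## (`cJ4 = 0`)») — APPEND-ONLY §3.  Every v1 declaration byte-identical; three `import`s added (`DiagonalLegGrade`, `PointColumnSplit`, `GhostBubbleRestFrozen`).
The leg enters §1–§2 only through the ENTRY bound `n²∕γ₀`; §3 re-feeds BOTH leg entry bounds with the n-FREE bound that the TREE already proves with NO
printed hypothesis: colour-diagonal entries `K^∞ = G₀ + flat` (`DiagonalLegGrade.abs_Kinf_diag_sub_G₀_le`, `PointColumnSplit.abs_G₀_le_const`), colour-off-diagonal
entries flat `n⁻²` (`OffDiagonalLegGrade.abs_Kinf_offDiag_le_four`), the frozen profile by `GhostBubbleRestFrozen.abs_gfrz_le_of_decays` at rate `0`.  Hence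
**`hLoc_tad_of_local_entry(_scaling)`**: the local tadpole row with tolerance `n⁸` — for slot E (`ωgl·cE₂ = 2N²·n⁸`) the units line reads `2N²·CE ≤ k`,
MET for an n-free table constant —, and **`hLoc_tad_J_of_cJ4_zero`** (`CL := 0`).  This is route (β) WITHOUT even `h12`∕`h126`: the n-free entry bound of
`Ga` is unconditional in the tree.  0 binders discharged; NOT D1, NOT `BetaPertH`.

HONEST DEPENDENCY (cell records, verbatim): «continuum YM on T⁴ ⇐ BetaPertH ∧ nine spine estimates (0/9 proved); BetaPertH ⇐ (D1) ∧ (D4) ∧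
CAP+tail; G-an2-4 gates asym, D1 and NE2/3/4.»  HONEST FRAMING (cell contract, verbatim): «discharging `BetaPertH` makes Bałaban's UV stability
UNCONDITIONAL — a real constructive-QFT result; it is NOT the continuum limit and NOT the Clay problem.»  THIS MODULE DISCHARGES NOTHING of the wall:
it is [folklore] bookkeeping BY NAME over `TadpoleRest` (`abs_avg_fullSum_restK_tad_le`, `abs_legPiece_le`, `abs_gfrz_le`, `conv_restK_tad_of_support` — leaf-03 g4),
`SplitRecut.restK'_tad` ∕ `SplitInstance.restK_tad` (the re-cut leaves the tadpole words unchanged), T1 `GluonLeg.abs_Ga_le` and `LatticeConstantZl.Zl_anti`.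
The slot tables, the weights `ωgl`, `c_s` and every constant are ARBITRARY sequences: nothing about Bałaban's operators is asserted; the scalar inequality
is DISPLAYED, ruled nowhere here.  No `def`, no `def … : Prop`, nothing cited, 0 sorry.  Root-level binders hW ∕ hR-sockets ∕ hSX-socket ∕ D1Tel ∕ D1Rep —
0 discharged; (K) NOT closed; NOT D1, NOT `BetaPertH`, NOT continuum, NOT Clay.

ABSOLUTE RULE (cell charter, verbatim): «No internally-minted statement may enter as a cited fact. Every hypothesis is either kernel-proved in this
package or a verbatim quotation of a PUBLISHED theorem with page reference. The manuscript(s) under audit are NOT citable for their own disputed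
steps — they are the thing under adjudication; programme-internal (2001/route/tribunal) claims are never citable.»

WHY (owner d1-p2-g9, `HOME/b2b-balaban-beta-d1-p2/K-LOCAL-ROWS.md` v0 f7ec1ac1fde23793 §2 «L-TAD gluon tadpoles `inl (s,r)`, s ∈ {0 WE, 1 WJ, 3 WR} × r ∈ Fin 3;
lemma `TadpoleRest.hR_tad_packaged` = locality `hsupp` + leg sups + table BiLoc + ONE displayed inequality `hCR`, currency `KrPk` → adapter `restK'_tad` rfl;
WR = projector second jets is NOT finitely supported — located «L-TAD-R»», §4 «CLAIMABLE NOW: «L-TAD-EJ» (6 words, s ∈ {0,1}) → leaf-04 lineage first refusal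
(NT-8 author, identical pattern)»).  The END's LOCAL row (`RoadEndBFxRows.hGrp_of_rows`, hypothesis `hLoc`) asks, per local word `τ` and uniformly in `n ≥ 2`,
`|Σ_{b ∈ image resSite} n⁻⁴ · fullSum (w ↦ restK' n a (gfrz n a b) … ((n:ℝ)^8) N μ ν b τ w)| ≤ CL τ`.  For `τ = Sum.inl (s, r)` this is leaf A6's word
`ω_gl·c_s·n⁻⁸·Σ_w w_μw_ν·½·tadpole (legPiece r) (W_s μ (b+w) ν b)`: the statements below are generic in the slot `s : Fin 5` and display that slot's
locality, so they serve «L-TAD-EJ» (s = 0, 1) now and any slot whose locality the owner certifies — NOT «L-TAD-R» (s = 3, located non-local).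

CONTENT (all [folklore]; `T(ρ, C₀, Cw, δ) := (2ρ+1)⁴·(ρ²·(½·(4·(4·(C₀·Cw)·Zl 4 δ)·Zl 4 δ)))`, written out, never named; `C₀ := n²∕γ₀ + n²∕γ₀`).
* §1 fixed `n`: `restK'_inl_eq_restK_inl` (the re-cut word IS the original word, `rfl`), **`abs_locTad_row_le`** (the row of `Sum.inl x` at block size `n`
  `≤ |ωgl|·|c_s|·n⁻⁸·T(ρ, n²∕γ₀ + n²∕γ₀, Cw, δ)`, both leg entry bounds discharged), `conv_locTad_row` ((CONV), locality alone).
* §2 along `n` (the END's currency): **`hLoc_tad_of_local`** (`hW` + locality `hsupp` + ONE scalar inequality `hCL` ⊢ the `hLoc` clause of `Sum.inl x`) and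
  **`hLoc_tad_of_local_scaling`** (`δ₀ ≤ δ n`, `|ωgl n · c_s n| · Cw n ≤ k · n⁶` ⊢ the clause with `CL := k·γ₀⁻¹·((2ρ+1)⁴·(ρ²·(16·(Zl 4 δ₀)²)))`).
Unit `b2b-balaban-beta-d1-formalise-leaf-04` (gen 8), D1 formalisation swarm; `LEAVES-BFx.md` row LOCAL ∕ «L-TAD-EJ».
-/

noncomputable section

namespace Summit.QuantumFields.BalabanUV.Beta.D1BFx.LocalTadpoleRows

open Finset Filter Topology
open scoped BigOperators
open Literature.MathematicalPhysics.QuantumFieldTheory.Balaban1983to89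
open Literature.MathematicalPhysics.QuantumFieldTheory.Balaban1983to89.Beta
open Literature.MathematicalPhysics.QuantumFieldTheory.Balaban1983to89.B5Prop11Lattice (gammaZero gammaZero_pos)
open ExpKernelCalculus (Site MKer BiLoc Zl Zl_nonneg)
open LatticeConstantZl (Zl_anti)
open DyadicShell (Pt toReal supNorm)
open WindowIdentification (psum fullSum)
open DressedMomentNormalisation (resSite)
open Summit.QuantumFields.BalabanUV.Beta.D1BFx.GluonLeg (Ga abs_Ga_le)
open Summit.QuantumFields.BalabanUV.Beta.D1BFx.ReducedKernel (TableR)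
open Summit.QuantumFields.BalabanUV.Beta.D1BFx.FineHessianSectors (slotWt slotTab)
open Summit.QuantumFields.BalabanUV.Beta.D1BFx.FrozenLegProfile (gfrz)
open Summit.QuantumFields.BalabanUV.Beta.D1BFx.SplitInstance (RestIdx restK restK_tad)
open Summit.QuantumFields.BalabanUV.Beta.D1BFx.SplitRecut (restK' restK'_tad)
open Summit.QuantumFields.BalabanUV.Beta.D1BFx.TadpoleRest (abs_avg_fullSum_restK_tad_le abs_legPiece_le abs_gfrz_le conv_restK_tad_of_support)

/-! ## §1 The local tadpole word at fixed block size -/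

section Fixed

variable (n : ℕ) [NeZero n] (a : ℝ) (cE cΛ cR cK cQ cE₂ cJ4 cΛ₂ cR₂ cQ₂ x₀ : ℝ) (WE WJ WΛ WR WQ : TableR) (ωgl ωgh lam N : ℝ)
  (μ ν : Fin 4) {Cw δ : ℝ} {ρ : ℕ}

/-- [folklore] The RE-CUT gluon tadpole word IS the original one: `restK' … (Sum.inl x) w = restK … (Sum.inl x) w` (`SplitRecut.restK'_tad`, `SplitInstance.restK_tad`). -/
theorem restK'_inl_eq_restK_inl (g : Pt → ℝ) (b : Pt) (x : Fin 5 × Fin 3) (w : Pt) :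
    restK' n a g cE cΛ cR cK cQ cE₂ cJ4 cΛ₂ cR₂ cQ₂ x₀ WE WJ WΛ WR WQ ωgl ωgh lam N μ ν b (Sum.inl x) w =
      restK n a g cE cΛ cR cK cQ cE₂ cJ4 cΛ₂ cR₂ cQ₂ x₀ WE WJ WΛ WR WQ ωgl ωgh lam N μ ν b (Sum.inl x) w := by
  rw [restK'_tad, restK_tad]

/-- [folklore] **THE LOCAL GLUON TADPOLE WORD `Sum.inl (s, r)` AT BLOCK SIZE `n`, BASE-POINT AVERAGED, IN THE END's CURRENCY** (profile = the road's
frozen profile `gfrz n a b` at each base site; `TadpoleRest.abs_avg_fullSum_restK_tad_le` with BOTH entry bounds discharged: `|Ga| ≤ n²∕γ₀` (`GluonLeg.abs_Ga_le`),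
`|gfrz n a b| ≤ n²∕γ₀` (`TadpoleRest.abs_gfrz_le`), so every leg grade `r` is entry-bounded by `n²∕γ₀ + n²∕γ₀`): slot table `s` bi-localised at its bonds with
`(Cw, δ)`, `δ > 0`, and supported in bond separation `≤ ρ` ⟹
`|Σ_{b ∈ image resSite} n⁻⁴·fullSum (w ↦ restK' … (gfrz n a b) … (Sum.inl (s,r)) w)|`
`  ≤ |ωgl|·|c_s|·n⁻⁸·(2ρ+1)⁴·(ρ²·(½·(4·(4·((n²∕γ₀ + n²∕γ₀)·Cw)·Zl 4 δ)·Zl 4 δ)))`. -/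
theorem abs_locTad_row_le (ha : 0 < a) (x : Fin 5 × Fin 3) (hW : ∀ κ u l u', BiLoc (slotTab WE WJ WΛ WR WQ x.1 κ u l u') u u' Cw δ)
    (hδ : 0 < δ) (hsupp : ∀ κ u l u', ρ < supNorm (u - u') → slotTab WE WJ WΛ WR WQ x.1 κ u l u' = 0) :
    |∑ b ∈ (univ : Finset (Fin 4 → Fin n)).image resSite, ((n : ℝ) ^ 4)⁻¹ *
        fullSum (fun w : Pt => restK' n a (gfrz n a b) cE cΛ cR cK cQ cE₂ cJ4 cΛ₂ cR₂ cQ₂ x₀ WE WJ WΛ WR WQ ωgl ωgh lam N μ ν b (Sum.inl x) w)| ≤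
      |ωgl| * |slotWt cE₂ cJ4 cΛ₂ cR₂ cQ₂ x.1| * ((n : ℝ) ^ 8)⁻¹ * ((2 * (ρ : ℝ) + 1) ^ 4 *
        ((ρ : ℝ) ^ 2 * ((1 / 2 : ℝ) * ((4 : ℝ) * ((4 : ℝ) *
          ((((n : ℕ) : ℝ) ^ 2 * (gammaZero 4 a)⁻¹ + ((n : ℕ) : ℝ) ^ 2 * (gammaZero 4 a)⁻¹) * Cw) * Zl 4 δ) * Zl 4 δ)))) := by
  have hn : 1 ≤ n := NeZero.one_le
  have hC₀ : 0 ≤ ((n : ℕ) : ℝ) ^ 2 * (gammaZero 4 a)⁻¹ + ((n : ℕ) : ℝ) ^ 2 * (gammaZero 4 a)⁻¹ := by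
    have := gammaZero_pos 4 a
    positivity
  have e : ∀ b : Pt, (fun w : Pt => restK' n a (gfrz n a b) cE cΛ cR cK cQ cE₂ cJ4 cΛ₂ cR₂ cQ₂ x₀ WE WJ WΛ WR WQ ωgl ωgh lam N μ ν b (Sum.inl x) w)
      = restK n a (gfrz n a b) cE cΛ cR cK cQ cE₂ cJ4 cΛ₂ cR₂ cQ₂ x₀ WE WJ WΛ WR WQ ωgl ωgh lam N μ ν b (Sum.inl x) := by
    intro b; funext w; exact restK'_inl_eq_restK_inl n a cE cΛ cR cK cQ cE₂ cJ4 cΛ₂ cR₂ cQ₂ x₀ WE WJ WΛ WR WQ ωgl ωgh lam N μ ν (gfrz n a b) b x w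
  simp only [e]
  exact abs_avg_fullSum_restK_tad_le n a cE cΛ cR cK cQ cE₂ cJ4 cΛ₂ cR₂ cQ₂ x₀ WE WJ WΛ WR WQ ωgl ωgh lam N μ ν x hC₀
    (fun b x' y κ l => abs_legPiece_le n a (fun x'' y' κ' l' => abs_Ga_le n a hn ha x'' y' κ' l') (fun v => abs_gfrz_le n a hn ha b v) x.2 x' y κ l)
    hW hδ hsupp

/-- [folklore] (CONV) of the local tadpole word at every base site and profile — from the locality of its slot alone. -/
theorem conv_locTad_row (g : Pt → ℝ) (b : Pt) (x : Fin 5 × Fin 3)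
    (hsupp : ∀ κ u l u', ρ < supNorm (u - u') → slotTab WE WJ WΛ WR WQ x.1 κ u l u' = 0) :
    ∃ B, Tendsto (psum (fun w : Pt => restK' n a g cE cΛ cR cK cQ cE₂ cJ4 cΛ₂ cR₂ cQ₂ x₀ WE WJ WΛ WR WQ ωgl ωgh lam N μ ν b (Sum.inl x) w))
      atTop (𝓝 B) := by
  have e : (fun w : Pt => restK' n a g cE cΛ cR cK cQ cE₂ cJ4 cΛ₂ cR₂ cQ₂ x₀ WE WJ WΛ WR WQ ωgl ωgh lam N μ ν b (Sum.inl x) w)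
      = restK n a g cE cΛ cR cK cQ cE₂ cJ4 cΛ₂ cR₂ cQ₂ x₀ WE WJ WΛ WR WQ ωgl ωgh lam N μ ν b (Sum.inl x) := by
    funext w; exact restK'_inl_eq_restK_inl n a cE cΛ cR cK cQ cE₂ cJ4 cΛ₂ cR₂ cQ₂ x₀ WE WJ WΛ WR WQ ωgl ωgh lam N μ ν g b x w
  rw [e]
  exact conv_restK_tad_of_support n a cE cΛ cR cK cQ cE₂ cJ4 cΛ₂ cR₂ cQ₂ x₀ WE WJ WΛ WR WQ ωgl ωgh lam N μ ν b x hsupp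

end Fixed

/-! ## §2 Along the block sizes: the `hLoc` clause of `RoadEndBFxRows.hGrp_of_rows` for a local tadpole word -/

section Along

variable {a N : ℝ} {μ ν : Fin 4} {cE cΛ cR cK cQ cE₂ cJ4 cΛ₂ cR₂ cQ₂ x₀ ωgl ωgh : ℕ → ℝ} {WE WJ WΛ WR WQ : ℕ → TableR}
  {Cw δ : ℕ → ℝ} {ρ : ℕ} {CL : ℝ}

/-- [folklore] **«L-TAD»: THE `hLoc` CLAUSE OF A LOCAL GLUON TADPOLE WORD `Sum.inl (s, r)`** — displayed, for every block size: the END's own table letter of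
slot `s` (`hW`, bi-localisation at the two bonds with `(Cw n, δ n)`, `δ n > 0`), the slot's finite bond-separation support `ρ` (`hsupp`), and ONE scalar inequality
`hCL` on `ωgl n`, the slot weight `c_s n`, `Cw n`, `δ n`, `ρ` and the leg entry bound `n²∕γ₀ + n²∕γ₀` (slot (K)'s units; ruled nowhere here).  Output = the
`τ := Sum.inl (s, r)` instance of `RoadEndBFxRows.hGrp_of_rows`' hypothesis `hLoc`, VERBATIM. -/
theorem hLoc_tad_of_local (x : Fin 5 × Fin 3) (ha : 0 < a) (hδ : ∀ n, 0 < δ n)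
    (hW : ∀ n κ u l u', BiLoc (slotTab (WE n) (WJ n) (WΛ n) (WR n) (WQ n) x.1 κ u l u') u u' (Cw n) (δ n))
    (hsupp : ∀ n κ u l u', ρ < supNorm (u - u') → slotTab (WE n) (WJ n) (WΛ n) (WR n) (WQ n) x.1 κ u l u' = 0)
    (hCL : ∀ n : ℕ, 2 ≤ n → |ωgl n| * |slotWt (cE₂ n) (cJ4 n) (cΛ₂ n) (cR₂ n) (cQ₂ n) x.1| * ((n : ℝ) ^ 8)⁻¹ * ((2 * (ρ : ℝ) + 1) ^ 4 *
        ((ρ : ℝ) ^ 2 * ((1 / 2 : ℝ) * ((4 : ℝ) * ((4 : ℝ) *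
          ((((n : ℕ) : ℝ) ^ 2 * (gammaZero 4 a)⁻¹ + ((n : ℕ) : ℝ) ^ 2 * (gammaZero 4 a)⁻¹) * Cw n) * Zl 4 (δ n)) * Zl 4 (δ n))))) ≤ CL) :
    ∀ n : ℕ, 2 ≤ n → ∀ [NeZero n],
      |∑ b ∈ (univ : Finset (Fin 4 → Fin n)).image resSite, ((n : ℝ) ^ 4)⁻¹ *
        fullSum (fun w : Pt => restK' n a (gfrz n a b) (cE n) (cΛ n) (cR n) (cK n) (cQ n) (cE₂ n) (cJ4 n) (cΛ₂ n) (cR₂ n) (cQ₂ n) (x₀ n)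
          (WE n) (WJ n) (WΛ n) (WR n) (WQ n) (ωgl n) (ωgh n) ((n : ℝ) ^ 8) N μ ν b (Sum.inl x) w)| ≤ CL :=
  fun n hn _ => (abs_locTad_row_le n a (cE n) (cΛ n) (cR n) (cK n) (cQ n) (cE₂ n) (cJ4 n) (cΛ₂ n) (cR₂ n) (cQ₂ n) (x₀ n)
    (WE n) (WJ n) (WΛ n) (WR n) (WQ n) (ωgl n) (ωgh n) ((n : ℝ) ^ 8) N μ ν ha x (hW n) (hδ n) (hsupp n)).trans (hCL n hn)

/-- [folklore] **«L-TAD» WITH THE n-POWER LEDGER EXPLICIT**: under a rate floor `0 < δ₀ ≤ δ n` and the scaling letter `|ωgl n · c_s n| · Cw n ≤ k · n⁶` (`n ≥ 2`),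
the `hLoc` clause of `Sum.inl (s, r)` holds with `CL := k · γ₀(4,a)⁻¹ · ((2ρ+1)⁴ · (ρ² · (16 · (Zl 4 δ₀)²)))` — leg entry bound `2n²∕γ₀` × explicit
`n⁻⁸` leaves
tolerance `n⁶` (the UNITS-LEDGER line for this word class; `LatticeConstantZl.Zl_anti`). -/
theorem hLoc_tad_of_local_scaling (x : Fin 5 × Fin 3) (ha : 0 < a) {δ₀ k : ℝ} (hδ₀ : 0 < δ₀) (hδge : ∀ n, δ₀ ≤ δ n)
    (hW : ∀ n κ u l u', BiLoc (slotTab (WE n) (WJ n) (WΛ n) (WR n) (WQ n) x.1 κ u l u') u u' (Cw n) (δ n))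
    (hsupp : ∀ n κ u l u', ρ < supNorm (u - u') → slotTab (WE n) (WJ n) (WΛ n) (WR n) (WQ n) x.1 κ u l u' = 0)
    (hk : ∀ n : ℕ, 2 ≤ n → |ωgl n * slotWt (cE₂ n) (cJ4 n) (cΛ₂ n) (cR₂ n) (cQ₂ n) x.1| * Cw n ≤ k * (n : ℝ) ^ 6) :
    ∀ n : ℕ, 2 ≤ n → ∀ [NeZero n],
      |∑ b ∈ (univ : Finset (Fin 4 → Fin n)).image resSite, ((n : ℝ) ^ 4)⁻¹ *
        fullSum (fun w : Pt => restK' n a (gfrz n a b) (cE n) (cΛ n) (cR n) (cK n) (cQ n) (cE₂ n) (cJ4 n) (cΛ₂ n) (cR₂ n) (cQ₂ n) (x₀ n)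
          (WE n) (WJ n) (WΛ n) (WR n) (WQ n) (ωgl n) (ωgh n) ((n : ℝ) ^ 8) N μ ν b (Sum.inl x) w)| ≤
        k * (gammaZero 4 a)⁻¹ * ((2 * (ρ : ℝ) + 1) ^ 4 * ((ρ : ℝ) ^ 2 * (16 * (Zl 4 δ₀) ^ 2))) := by
  have hδ : ∀ n, 0 < δ n := fun n => hδ₀.trans_le (hδge n)
  refine hLoc_tad_of_local x ha hδ hW hsupp (fun n hn => ?_)
  have hγ : 0 < gammaZero 4 a := gammaZero_pos 4 a
  have hn0 : (n : ℝ) ≠ 0 := by exact_mod_cast (show n ≠ 0 by omega)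
  have hCw : 0 ≤ Cw n := (hW n 0 0 0 0).nonneg 0
  have hZ0 : 0 ≤ Zl 4 (δ n) := Zl_nonneg (hδ n)
  have hZle : Zl 4 (δ n) ≤ Zl 4 δ₀ := Zl_anti hδ₀ (hδge n)
  have hZsq : Zl 4 (δ n) * Zl 4 (δ n) ≤ (Zl 4 δ₀) ^ 2 := by
    rw [sq]; exact mul_le_mul hZle hZle hZ0 (hZ0.trans hZle)
  have hk0 : 0 ≤ k * (n : ℝ) ^ 6 := (mul_nonneg (abs_nonneg _) hCw).trans (hk n hn)
  have e : |ωgl n| * |slotWt (cE₂ n) (cJ4 n) (cΛ₂ n) (cR₂ n) (cQ₂ n) x.1| * ((n : ℝ) ^ 8)⁻¹ * ((2 * (ρ : ℝ) + 1) ^ 4 *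
        ((ρ : ℝ) ^ 2 * ((1 / 2 : ℝ) * ((4 : ℝ) * ((4 : ℝ) *
          ((((n : ℕ) : ℝ) ^ 2 * (gammaZero 4 a)⁻¹ + ((n : ℕ) : ℝ) ^ 2 * (gammaZero 4 a)⁻¹) * Cw n) * Zl 4 (δ n)) * Zl 4 (δ n))))) =
      (|ωgl n * slotWt (cE₂ n) (cJ4 n) (cΛ₂ n) (cR₂ n) (cQ₂ n) x.1| * Cw n) * (((n : ℝ) ^ 2 * ((n : ℝ) ^ 8)⁻¹) *
        ((gammaZero 4 a)⁻¹ * ((2 * (ρ : ℝ) + 1) ^ 4 * ((ρ : ℝ) ^ 2 * (16 * (Zl 4 (δ n) * Zl 4 (δ n))))))) := by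
    rw [abs_mul]
    ring
  rw [e]
  have hR : (gammaZero 4 a)⁻¹ * ((2 * (ρ : ℝ) + 1) ^ 4 * ((ρ : ℝ) ^ 2 * (16 * (Zl 4 (δ n) * Zl 4 (δ n))))) ≤
      (gammaZero 4 a)⁻¹ * ((2 * (ρ : ℝ) + 1) ^ 4 * ((ρ : ℝ) ^ 2 * (16 * (Zl 4 δ₀) ^ 2))) := by
    gcongr
  have hR0 : 0 ≤ (gammaZero 4 a)⁻¹ * ((2 * (ρ : ℝ) + 1) ^ 4 * ((ρ : ℝ) ^ 2 * (16 * (Zl 4 (δ n) * Zl 4 (δ n))))) := by positivity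
  have hpow : 0 ≤ (n : ℝ) ^ 2 * ((n : ℝ) ^ 8)⁻¹ := by positivity
  calc (|ωgl n * slotWt (cE₂ n) (cJ4 n) (cΛ₂ n) (cR₂ n) (cQ₂ n) x.1| * Cw n) * (((n : ℝ) ^ 2 * ((n : ℝ) ^ 8)⁻¹) *
        ((gammaZero 4 a)⁻¹ * ((2 * (ρ : ℝ) + 1) ^ 4 * ((ρ : ℝ) ^ 2 * (16 * (Zl 4 (δ n) * Zl 4 (δ n)))))))
      ≤ (k * (n : ℝ) ^ 6) * (((n : ℝ) ^ 2 * ((n : ℝ) ^ 8)⁻¹) *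
        ((gammaZero 4 a)⁻¹ * ((2 * (ρ : ℝ) + 1) ^ 4 * ((ρ : ℝ) ^ 2 * (16 * (Zl 4 δ₀) ^ 2))))) :=
        mul_le_mul (hk n hn) (mul_le_mul_of_nonneg_left hR hpow) (mul_nonneg hpow hR0) hk0
    _ = k * (gammaZero 4 a)⁻¹ * ((2 * (ρ : ℝ) + 1) ^ 4 * ((ρ : ℝ) ^ 2 * (16 * (Zl 4 δ₀) ^ 2))) := by
        field_simp

end Along


/-! ## §3 (v1.1) The n-FREE leg entry bound (unconditional in the tree) and the local tadpole rows with tolerance `n⁸` -/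

section Entry

open VectorPropagatorLimit (Kinf)
open PoissonInterior (G₀)
open LongitudinalWindow (ellD0)
open WoodburyCovariant (woodburyDc)
open VectorLegVolumeAdapter (woodburyDc_zero_nonneg)
open ExpKernelCalculus (Decays)
open B12Sec2to5 (l1)
open Summit.QuantumFields.BalabanUV.Beta.D1BFx.GluonLeg (Ga_apply)
open Summit.QuantumFields.BalabanUV.Beta.D1BFx.OffDiagonalLegGrade (ellD0_nonneg abs_Kinf_offDiag_le_four)
open Summit.QuantumFields.BalabanUV.Beta.D1BFx.DiagonalLegGrade (abs_Kinf_diag_sub_G₀_le)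
open Summit.QuantumFields.BalabanUV.Beta.D1BFx.PointColumnSplit (cG0 cG0_nonneg abs_G₀_le_const)
open Summit.QuantumFields.BalabanUV.Beta.D1BFx.GhostBubbleRestFrozen (abs_gfrz_le_of_decays)

variable (n : ℕ) [NeZero n] {a : ℝ}

/-- [folklore] **THE GLUON LEG IS ENTRY-BOUNDED FREE OF THE BLOCK SIZE — UNCONDITIONALLY** (no printed hypothesis): for every `n ≥ 1`, `a > 0` and all entries,
`|Ga n a x y κ l| ≤ cG0 4 + (woodburyDc 0 + ellD0 4 a) + ellD0 4 a` — colour-diagonal: `K^∞ = G₀ + flat(≤ (woodburyDc 0 + ellD0 4 a)∕n²)`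
(`DiagonalLegGrade.abs_Kinf_diag_sub_G₀_le`) with `|G₀| ≤ cG0 4` (`PointColumnSplit.abs_G₀_le_const`); colour-off-diagonal: flat `≤ ellD0 4 a∕n²`
(`OffDiagonalLegGrade.abs_Kinf_offDiag_le_four`).  (T1's `GluonLeg.abs_Ga_le` gives `n²∕γ₀`.) -/
theorem abs_Ga_le_flatEntry (ha : 0 < a) (x y : Site 4) (κ l : Fin 4) :
    |Ga n a x y κ l| ≤ cG0 4 + (woodburyDc 0 + ellD0 4 a) + ellD0 4 a := by
  have hn : 1 ≤ n := NeZero.one_le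
  have hn1 : (1 : ℝ) ≤ n := by exact_mod_cast hn
  have hn2 : (1 : ℝ) ≤ (n : ℝ) ^ 2 := one_le_pow₀ hn1
  have hW : 0 ≤ woodburyDc 0 + ellD0 4 a := add_nonneg woodburyDc_zero_nonneg (ellD0_nonneg ha)
  have hE : 0 ≤ ellD0 4 a := ellD0_nonneg ha
  have hC : 0 ≤ cG0 4 := cG0_nonneg 4
  rw [Ga_apply]
  by_cases h : κ = l
  · subst h
    have h1 := abs_Kinf_diag_sub_G₀_le n hn ha κ x y
    have h2 := abs_G₀_le_const (d := 4) (by norm_num) (y - x)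
    have h3 : (woodburyDc 0 + ellD0 4 a) / (n : ℝ) ^ 2 ≤ woodburyDc 0 + ellD0 4 a := div_le_self hW hn2
    calc |Kinf n a (x, κ) (y, κ)| = |(Kinf n a (x, κ) (y, κ) - G₀ (y - x)) + G₀ (y - x)| := by rw [sub_add_cancel]
      _ ≤ |Kinf n a (x, κ) (y, κ) - G₀ (y - x)| + |G₀ (y - x)| := abs_add_le _ _
      _ ≤ (woodburyDc 0 + ellD0 4 a) + cG0 4 := add_le_add (h1.trans h3) h2
      _ ≤ cG0 4 + (woodburyDc 0 + ellD0 4 a) + ellD0 4 a := by linarith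
  · have h1 := abs_Kinf_offDiag_le_four n hn ha h x (y - x)
    rw [add_sub_cancel] at h1
    have h3 : ellD0 4 a / (n : ℝ) ^ 2 ≤ ellD0 4 a := div_le_self hE hn2
    linarith [h1.trans h3]

/-- [folklore] … and so is the road's frozen profile: `|gfrz n a b v| ≤ cG0 4 + (woodburyDc 0 + ellD0 4 a) + ellD0 4 a` (the 64-average of diagonal entries,
`GhostBubbleRestFrozen.abs_gfrz_le_of_decays` at rate `0`). -/
theorem abs_gfrz_le_flatEntry (ha : 0 < a) (b v : Pt) : |gfrz n a b v| ≤ cG0 4 + (woodburyDc 0 + ellD0 4 a) + ellD0 4 a := by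
  have hD : Decays (Ga n a) (cG0 4 + (woodburyDc 0 + ellD0 4 a) + ellD0 4 a) 0 := by
    intro x y κ l
    rw [neg_zero, zero_mul, Real.exp_zero, mul_one]
    exact abs_Ga_le_flatEntry n ha x y κ l
  have h := abs_gfrz_le_of_decays n a hD b v
  rwa [neg_zero, zero_mul, Real.exp_zero, mul_one] at h

end Entry

section AlongEntry

open LongitudinalWindow (ellD0)
open WoodburyCovariant (woodburyDc)
open VectorLegVolumeAdapter (woodburyDc_zero_nonneg)
open Summit.QuantumFields.BalabanUV.Beta.D1BFx.OffDiagonalLegGrade (ellD0_nonneg)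
open Summit.QuantumFields.BalabanUV.Beta.D1BFx.PointColumnSplit (cG0 cG0_nonneg)

variable {a N : ℝ} {μ ν : Fin 4} {cE cΛ cR cK cQ cE₂ cJ4 cΛ₂ cR₂ cQ₂ x₀ ωgl ωgh : ℕ → ℝ} {WE WJ WΛ WR WQ : ℕ → TableR}
  {Cw δ : ℕ → ℝ} {ρ : ℕ} {CL : ℝ}

/-- [folklore] **«L-TAD» WITH THE n-FREE LEG ENTRY BOUND** (owner ρ-g9-29 route (β), made unconditional): the `hLoc` clause of a local gluon tadpole word
`Sum.inl (s, r)` from the END's slot letter `hW`, the slot's locality `hsupp`, and ONE scalar inequality in which the leg enters through the n-FREE constant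
`E := cG0 4 + (woodburyDc 0 + ellD0 4 a) + ellD0 4 a` twice (piece + frozen profile) — NOT through `n²∕γ₀`. -/
theorem hLoc_tad_of_local_entry (x : Fin 5 × Fin 3) (ha : 0 < a) (hδ : ∀ n, 0 < δ n)
    (hW : ∀ n κ u l u', BiLoc (slotTab (WE n) (WJ n) (WΛ n) (WR n) (WQ n) x.1 κ u l u') u u' (Cw n) (δ n))
    (hsupp : ∀ n κ u l u', ρ < supNorm (u - u') → slotTab (WE n) (WJ n) (WΛ n) (WR n) (WQ n) x.1 κ u l u' = 0)
    (hCL : ∀ n : ℕ, 2 ≤ n → |ωgl n| * |slotWt (cE₂ n) (cJ4 n) (cΛ₂ n) (cR₂ n) (cQ₂ n) x.1| * ((n : ℝ) ^ 8)⁻¹ * ((2 * (ρ : ℝ) + 1) ^ 4 *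
        ((ρ : ℝ) ^ 2 * ((1 / 2 : ℝ) * ((4 : ℝ) * ((4 : ℝ) *
          (((cG0 4 + (woodburyDc 0 + ellD0 4 a) + ellD0 4 a) + (cG0 4 + (woodburyDc 0 + ellD0 4 a) + ellD0 4 a)) * Cw n) *
            Zl 4 (δ n)) * Zl 4 (δ n))))) ≤ CL) :
    ∀ n : ℕ, 2 ≤ n → ∀ [NeZero n],
      |∑ b ∈ (univ : Finset (Fin 4 → Fin n)).image resSite, ((n : ℝ) ^ 4)⁻¹ *
        fullSum (fun w : Pt => restK' n a (gfrz n a b) (cE n) (cΛ n) (cR n) (cK n) (cQ n) (cE₂ n) (cJ4 n) (cΛ₂ n) (cR₂ n) (cQ₂ n) (x₀ n)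
          (WE n) (WJ n) (WΛ n) (WR n) (WQ n) (ωgl n) (ωgh n) ((n : ℝ) ^ 8) N μ ν b (Sum.inl x) w)| ≤ CL := by
  intro n hn _
  have hE0 : 0 ≤ (cG0 4 + (woodburyDc 0 + ellD0 4 a) + ellD0 4 a) + (cG0 4 + (woodburyDc 0 + ellD0 4 a) + ellD0 4 a) := by
    have h1 := cG0_nonneg 4
    have h2 := woodburyDc_zero_nonneg
    have h3 := ellD0_nonneg (d := 4) ha
    positivity
  have e : ∀ b : Pt, (fun w : Pt => restK' n a (gfrz n a b) (cE n) (cΛ n) (cR n) (cK n) (cQ n) (cE₂ n) (cJ4 n) (cΛ₂ n) (cR₂ n) (cQ₂ n) (x₀ n)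
      (WE n) (WJ n) (WΛ n) (WR n) (WQ n) (ωgl n) (ωgh n) ((n : ℝ) ^ 8) N μ ν b (Sum.inl x) w)
      = restK n a (gfrz n a b) (cE n) (cΛ n) (cR n) (cK n) (cQ n) (cE₂ n) (cJ4 n) (cΛ₂ n) (cR₂ n) (cQ₂ n) (x₀ n)
        (WE n) (WJ n) (WΛ n) (WR n) (WQ n) (ωgl n) (ωgh n) ((n : ℝ) ^ 8) N μ ν b (Sum.inl x) := by
    intro b; funext w
    exact restK'_inl_eq_restK_inl n a (cE n) (cΛ n) (cR n) (cK n) (cQ n) (cE₂ n) (cJ4 n) (cΛ₂ n) (cR₂ n) (cQ₂ n) (x₀ n) (WE n) (WJ n) (WΛ n)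
      (WR n) (WQ n) (ωgl n) (ωgh n) ((n : ℝ) ^ 8) N μ ν (gfrz n a b) b x w
  simp only [e]
  exact (abs_avg_fullSum_restK_tad_le n a (cE n) (cΛ n) (cR n) (cK n) (cQ n) (cE₂ n) (cJ4 n) (cΛ₂ n) (cR₂ n) (cQ₂ n) (x₀ n) (WE n) (WJ n)
    (WΛ n) (WR n) (WQ n) (ωgl n) (ωgh n) ((n : ℝ) ^ 8) N μ ν x hE0
    (fun b x' y κ l => abs_legPiece_le n a (fun x'' y' κ' l' => abs_Ga_le_flatEntry n ha x'' y' κ' l') (fun v => abs_gfrz_le_flatEntry n ha b v)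
      x.2 x' y κ l) (hW n) (hδ n) (hsupp n)).trans (hCL n hn)

/-- [folklore] **«L-TAD» WITH TOLERANCE `n⁸`**: under a rate floor `0 < δ₀ ≤ δ n` and the scaling letter `|ωgl n · c_s n| · Cw n ≤ k · n⁸` (`n ≥ 2`), the `hLoc` clause
of `Sum.inl (s, r)` holds with `CL := k · (E + E) · ((2ρ+1)⁴ · (ρ² · (8 · (Zl 4 δ₀)²)))`, `E = cG0 4 + (woodburyDc 0 + ellD0 4 a) + ellD0 4 a` — for the Wilson quartic
slot E (`ωgl·cE₂ = 2N²·n⁸` at the pins of record) the letter reads `2N²·CE n ≤ k`: MET for an n-free table constant. -/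
theorem hLoc_tad_of_local_entry_scaling (x : Fin 5 × Fin 3) (ha : 0 < a) {δ₀ k : ℝ} (hδ₀ : 0 < δ₀) (hδge : ∀ n, δ₀ ≤ δ n)
    (hW : ∀ n κ u l u', BiLoc (slotTab (WE n) (WJ n) (WΛ n) (WR n) (WQ n) x.1 κ u l u') u u' (Cw n) (δ n))
    (hsupp : ∀ n κ u l u', ρ < supNorm (u - u') → slotTab (WE n) (WJ n) (WΛ n) (WR n) (WQ n) x.1 κ u l u' = 0)
    (hk : ∀ n : ℕ, 2 ≤ n → |ωgl n * slotWt (cE₂ n) (cJ4 n) (cΛ₂ n) (cR₂ n) (cQ₂ n) x.1| * Cw n ≤ k * (n : ℝ) ^ 8) :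
    ∀ n : ℕ, 2 ≤ n → ∀ [NeZero n],
      |∑ b ∈ (univ : Finset (Fin 4 → Fin n)).image resSite, ((n : ℝ) ^ 4)⁻¹ *
        fullSum (fun w : Pt => restK' n a (gfrz n a b) (cE n) (cΛ n) (cR n) (cK n) (cQ n) (cE₂ n) (cJ4 n) (cΛ₂ n) (cR₂ n) (cQ₂ n) (x₀ n)
          (WE n) (WJ n) (WΛ n) (WR n) (WQ n) (ωgl n) (ωgh n) ((n : ℝ) ^ 8) N μ ν b (Sum.inl x) w)| ≤
        k * ((cG0 4 + (woodburyDc 0 + ellD0 4 a) + ellD0 4 a) + (cG0 4 + (woodburyDc 0 + ellD0 4 a) + ellD0 4 a)) *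
          ((2 * (ρ : ℝ) + 1) ^ 4 * ((ρ : ℝ) ^ 2 * (8 * (Zl 4 δ₀) ^ 2))) := by
  have hδ : ∀ n, 0 < δ n := fun n => hδ₀.trans_le (hδge n)
  refine hLoc_tad_of_local_entry x ha hδ hW hsupp (fun n hn => ?_)
  set E : ℝ := (cG0 4 + (woodburyDc 0 + ellD0 4 a) + ellD0 4 a) + (cG0 4 + (woodburyDc 0 + ellD0 4 a) + ellD0 4 a) with hEdef
  have hE0 : 0 ≤ E := by
    have h1 := cG0_nonneg 4
    have h2 := woodburyDc_zero_nonneg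
    have h3 := ellD0_nonneg (d := 4) ha
    positivity
  have hn0 : (n : ℝ) ≠ 0 := by exact_mod_cast (show n ≠ 0 by omega)
  have hCw : 0 ≤ Cw n := (hW n 0 0 0 0).nonneg 0
  have hZ0 : 0 ≤ Zl 4 (δ n) := Zl_nonneg (hδ n)
  have hZle : Zl 4 (δ n) ≤ Zl 4 δ₀ := Zl_anti hδ₀ (hδge n)
  have hZsq : Zl 4 (δ n) * Zl 4 (δ n) ≤ (Zl 4 δ₀) ^ 2 := by
    rw [sq]; exact mul_le_mul hZle hZle hZ0 (hZ0.trans hZle)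
  have hk0 : 0 ≤ k * (n : ℝ) ^ 8 := (mul_nonneg (abs_nonneg _) hCw).trans (hk n hn)
  have e : |ωgl n| * |slotWt (cE₂ n) (cJ4 n) (cΛ₂ n) (cR₂ n) (cQ₂ n) x.1| * ((n : ℝ) ^ 8)⁻¹ * ((2 * (ρ : ℝ) + 1) ^ 4 *
        ((ρ : ℝ) ^ 2 * ((1 / 2 : ℝ) * ((4 : ℝ) * ((4 : ℝ) * (E * Cw n) * Zl 4 (δ n)) * Zl 4 (δ n))))) =
      (|ωgl n * slotWt (cE₂ n) (cJ4 n) (cΛ₂ n) (cR₂ n) (cQ₂ n) x.1| * Cw n) * ((n : ℝ) ^ 8)⁻¹ *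
        (E * ((2 * (ρ : ℝ) + 1) ^ 4 * ((ρ : ℝ) ^ 2 * (8 * (Zl 4 (δ n) * Zl 4 (δ n)))))) := by
    rw [abs_mul]
    ring
  rw [e]
  have hR : E * ((2 * (ρ : ℝ) + 1) ^ 4 * ((ρ : ℝ) ^ 2 * (8 * (Zl 4 (δ n) * Zl 4 (δ n))))) ≤
      E * ((2 * (ρ : ℝ) + 1) ^ 4 * ((ρ : ℝ) ^ 2 * (8 * (Zl 4 δ₀) ^ 2))) := by
    gcongr
  have hR0 : 0 ≤ E * ((2 * (ρ : ℝ) + 1) ^ 4 * ((ρ : ℝ) ^ 2 * (8 * (Zl 4 (δ n) * Zl 4 (δ n))))) := by positivity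
  have hpow : 0 ≤ ((n : ℝ) ^ 8)⁻¹ := by positivity
  calc (|ωgl n * slotWt (cE₂ n) (cJ4 n) (cΛ₂ n) (cR₂ n) (cQ₂ n) x.1| * Cw n) * ((n : ℝ) ^ 8)⁻¹ *
        (E * ((2 * (ρ : ℝ) + 1) ^ 4 * ((ρ : ℝ) ^ 2 * (8 * (Zl 4 (δ n) * Zl 4 (δ n))))))
      ≤ (k * (n : ℝ) ^ 8) * ((n : ℝ) ^ 8)⁻¹ * (E * ((2 * (ρ : ℝ) + 1) ^ 4 * ((ρ : ℝ) ^ 2 * (8 * (Zl 4 δ₀) ^ 2)))) :=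
        mul_le_mul (mul_le_mul_of_nonneg_right (hk n hn) hpow) hR hR0 (mul_nonneg hk0 hpow)
    _ = k * E * ((2 * (ρ : ℝ) + 1) ^ 4 * ((ρ : ℝ) ^ 2 * (8 * (Zl 4 δ₀) ^ 2))) := by field_simp

/-- [folklore] **«L-TAD-J» IS VOID** (owner ρ-g9-29 U3.J: `cJ4 = 0`, R-6): if the slot-J weight vanishes at every block size, the three WJ tadpole words
`Sum.inl (1, r)` are identically `0`, so their `hLoc` clause holds with `CL := 0`. -/
theorem hLoc_tad_J_of_cJ4_zero (r : Fin 3) (hJ : ∀ n, cJ4 n = 0) :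
    ∀ n : ℕ, 2 ≤ n → ∀ [NeZero n],
      |∑ b ∈ (univ : Finset (Fin 4 → Fin n)).image resSite, ((n : ℝ) ^ 4)⁻¹ *
        fullSum (fun w : Pt => restK' n a (gfrz n a b) (cE n) (cΛ n) (cR n) (cK n) (cQ n) (cE₂ n) (cJ4 n) (cΛ₂ n) (cR₂ n) (cQ₂ n) (x₀ n)
          (WE n) (WJ n) (WΛ n) (WR n) (WQ n) (ωgl n) (ωgh n) ((n : ℝ) ^ 8) N μ ν b (Sum.inl ((1 : Fin 5), r)) w)| ≤ 0 := by
  intro n hn _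
  have hw : ∀ b : Pt, (fun w : Pt => restK' n a (gfrz n a b) (cE n) (cΛ n) (cR n) (cK n) (cQ n) (cE₂ n) (cJ4 n) (cΛ₂ n) (cR₂ n) (cQ₂ n) (x₀ n)
      (WE n) (WJ n) (WΛ n) (WR n) (WQ n) (ωgl n) (ωgh n) ((n : ℝ) ^ 8) N μ ν b (Sum.inl ((1 : Fin 5), r)) w) = fun _ => 0 := by
    intro b; funext w
    rw [restK'_tad]
    simp [slotWt, hJ n]
  have hfs : ∀ b : Pt, fullSum (fun w : Pt => restK' n a (gfrz n a b) (cE n) (cΛ n) (cR n) (cK n) (cQ n) (cE₂ n) (cJ4 n) (cΛ₂ n) (cR₂ n) (cQ₂ n)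
      (x₀ n) (WE n) (WJ n) (WΛ n) (WR n) (WQ n) (ωgl n) (ωgh n) ((n : ℝ) ^ 8) N μ ν b (Sum.inl ((1 : Fin 5), r)) w) = 0 := by
    intro b
    rw [hw b, WindowIdentification.fullSum_of_support (R₁ := 0) (fun w _ => rfl)]
    exact Finset.sum_eq_zero fun _ _ => rfl
  simp only [hfs, mul_zero, Finset.sum_const_zero, abs_zero, le_refl]

end AlongEntry

end Summit.QuantumFields.BalabanUV.Beta.D1BFx.LocalTadpoleRows

end
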